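import Summits.Ventures.HSemireg.UntwistCocycleTwistOne
import Summits.Ventures.HSemireg.UntwistCocycleTwistSigma
import Summits.Ventures.HSemireg.HigherSigmaOfIso
import Summits.Ventures.HSemireg.HomComplexSigmaConj
import HarnessLib

/-!
# Venture HSemireg — route R1.0 (untwisted reading): the semiregularity verdict of `E ⊗ M` depends only on the
# CLASS of `M` in `Ȟ¹(X, 𝒪_X^×)` — sheaf and complex carriers (th-4 file #32; sequel of #30, #31, #13)

HONEST FRAMING. Corollaries, on the tree's REAL semiregularity predicates, of the isomorphisms of files #30/#31
(`CocycleTwist.twistCongr`, `twistFunctorCongr`, `twistOneIso`) and of the landed isomorphism-invariance of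
`I`-semiregularity (`HigherSigmaOfIso.isISemiregular_iff_of_iso` for finite locally free modules, gs-g4;
`HomComplexSigmaConj.isISemiregularC_iff_of_iso` for strictly perfect complexes, t-7). Nothing is asserted about any
variety; no semiregularity is CLAIMED for any object; nothing here says HC, HC_CM or HC_AV is proved.

WHAT. In the untwisted reading of route R1.0 (lead R-49(a)/R-51(a): `E₀′ = E₀ ⊗ M_B` on `X₀`, `[M_B] ∈ Pic X₀` the integral
`B`-field class, t-12: `m` even) the object of record is written in the tree as the cocycle twist `E₀⟨c⟩` (#11) resp.
`cocycleTwistComplex c E₀` (#13) of a cocycle REPRESENTATIVE `c` of `[M_B]`. This file records that every statement the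
cell makes about it is a statement about the CLASS:
* `isISemiregular_twist_iff_of_coboundary` / `_of_equiv` / `_of_mk_eq_mk` — for `E` finite locally free on `X/S` and ANY
  set `I` of form degrees, `IsISemiregular (E⟨c⟩) I ↔ IsISemiregular (E⟨c′⟩) I` whenever `[c] = [c′]`
  (also `q`-semiregularity, `isHigherSemiregular_twist_iff_of_coboundary`);
* `isISemiregular_twist_one_iff`, `isISemiregular_twist_iff_self_of_mk_eq_one` — a twist of TRIVIAL class has the
  verdict of `E` itself;
* `cocycleTwistComplexCongr b E₀ : cocycleTwistComplex c E₀ ≅ cocycleTwistComplex c′ E₀` (termwise `twistCongr`, natural: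
  Mathlib `NatIso.mapHomologicalComplex` of `twistFunctorCongr`) and `isISemiregularC_cocycleTwistComplex_iff_of_coboundary`
  / `_of_mk_eq_mk` — for a STRICTLY PERFECT `E₀` (the two-term STEP-0 representative included) and any `I`,
  `IsISemiregularC X (E₀⟨c⟩) a b _ I ↔ IsISemiregularC X (E₀⟨c′⟩) a b _ I` whenever `[c] = [c′]`.
So «`E₀ ⊗ L⁻¹`, `L` a square root of `P`» (PERRY-SUBSTITUTE-GS R1.0) has ONE semiregularity verdict per class `[L]`,
independent of the cocycle and of the cover chosen to write `L` (#30 `twistRefineIso`). Which Ext groups: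
`Ext²(E⟨c⟩, E⟨c⟩) ≅ Ext²(E⟨c′⟩, E⟨c′⟩)` resp. `Hom_{D(X)}(Q E₀⟨c⟩, Q E₀⟨c⟩⟦2⟧)`, by conjugation; which class: `[c] = [c′]`;
which twist: `- ⊗ lineBundle c`.

## References

* R.-O. Buchweitz, H. Flenner, Compositio Math. 137 (2003), Def. 4.1, §5 (`I`-semiregular). [BuchweitzFlenner2003]
* R. Hartshorne, *Algebraic Geometry*, GTM 52 (1977), III Ex. 4.5 (`Pic X ≅ Ȟ¹(X, 𝒪_X^×)`). [Hartshorne1977]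
-/

noncomputable section

open CategoryTheory CategoryTheory.Abelian AlgebraicGeometry

namespace Summit.Ventures.HSemireg

open Literature.AlgebraicGeometry.Modules Literature.AlgebraicGeometry.Motives Literature.AlgebraicGeometry.HodgeTheory

namespace CocycleTwist

universe w u

variable {S : Type u} [CommRing S] {X : Over (Spec (CommRingCat.of S))}

/-! ### 1. Sheaf carriers: `E` finite locally free, real `σ_q = sigmaHigher` -/

section Sheaf

variable [HasExt.{w} X.left.Modules] {c c' : UnitCocycle X.left} {E : X.left.Modules} (hE : IsFiniteLocallyFree E)

/-- **The `I`-semiregularity verdict of `E ⊗ M` depends only on the class of `M`**: for a coboundary `b` from `c` to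
`c′`, `E⟨c⟩` is `I`-semiregular iff `E⟨c′⟩` is (conjugation by `twistCongr b E` intertwines every `σ_q`).
[cite: BuchweitzFlenner2003, §5 (I-semiregular); Hartshorne1977, III Ex. 4.5] -/
theorem isISemiregular_twist_iff_of_coboundary (b : UnitCocycle.Coboundary c c') (I : Set ℕ) :
    IsISemiregular.{w} (isFiniteLocallyFree_twist c hE) I ↔ IsISemiregular.{w} (isFiniteLocallyFree_twist c' hE) I :=
  isISemiregular_iff_of_iso (twistCongr b E) _ _ I

/-- The same for cohomologous cocycles (`Nonempty` form of the coboundary). [cite: BuchweitzFlenner2003, §5] -/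
theorem isISemiregular_twist_iff_of_equiv (h : UnitCocycle.Equiv c c') (I : Set ℕ) :
    IsISemiregular.{w} (isFiniteLocallyFree_twist c hE) I ↔ IsISemiregular.{w} (isFiniteLocallyFree_twist c' hE) I := by
  obtain ⟨b⟩ := h
  exact isISemiregular_twist_iff_of_coboundary hE b I

/-- **Equal classes in `Ȟ¹(X, 𝒪_X^×)` ⇒ the same `I`-semiregularity verdict for the twists of `E`.**
[cite: BuchweitzFlenner2003, §5 (I-semiregular); Hartshorne1977, III Ex. 4.5] -/
theorem isISemiregular_twist_iff_of_mk_eq_mk (h : CechPic.mk c = CechPic.mk c') (I : Set ℕ) :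
    IsISemiregular.{w} (isFiniteLocallyFree_twist c hE) I ↔ IsISemiregular.{w} (isFiniteLocallyFree_twist c' hE) I :=
  isISemiregular_twist_iff_of_equiv hE ((CechPic.mk_eq_mk_iff c c').1 h) I

/-- The `q`-semiregularity verdict (`I = {q}`) of `E ⊗ M` depends only on the class of `M`.
[cite: BuchweitzFlenner2003, §1 (k-semiregular)] -/
theorem isHigherSemiregular_twist_iff_of_coboundary (b : UnitCocycle.Coboundary c c') (q : ℕ) :
    IsHigherSemiregular.{w} (isFiniteLocallyFree_twist c hE) q ↔
      IsHigherSemiregular.{w} (isFiniteLocallyFree_twist c' hE) q :=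
  ⟨isHigherSemiregular_of_iso (twistCongr b E) _ _ q, isHigherSemiregular_of_iso (twistCongr b E).symm _ _ q⟩

/-- **A twist of trivial class has the verdict of `E` itself**: `E⟨1⟩` is `I`-semiregular iff `E` is (`twistOneIso`).
[cite: BuchweitzFlenner2003, §5 (I-semiregular)] -/
theorem isISemiregular_twist_one_iff (I : Set ℕ) :
    IsISemiregular.{w} (isFiniteLocallyFree_twist (UnitCocycle.one X.left) hE) I ↔ IsISemiregular.{w} hE I :=
  isISemiregular_iff_of_iso (twistOneIso E) _ _ I

/-- `[c] = 1` ⇒ `E⟨c⟩` is `I`-semiregular iff `E` is. [cite: BuchweitzFlenner2003, §5; Hartshorne1977, III Ex. 4.5] -/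
theorem isISemiregular_twist_iff_self_of_mk_eq_one (h : CechPic.mk c = 1) (I : Set ℕ) :
    IsISemiregular.{w} (isFiniteLocallyFree_twist c hE) I ↔ IsISemiregular.{w} hE I := by
  obtain ⟨e⟩ := nonempty_twist_iso_self_of_mk_eq_one E h
  exact isISemiregular_iff_of_iso e _ _ I

end Sheaf

/-! ### 2. Complex carriers: `E₀` strictly perfect, real `σ_q = HomComplex.sigmaC` -/

section Complex

variable {c c' : UnitCocycle X.left} (E₀ : CochainComplex X.left.Modules ℤ)

/-- **`E₀⟨c⟩ ≅ E₀⟨c′⟩` as cochain complexes** for a coboundary from `c` to `c′`: `twistCongr` termwise, compatible with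
the differentials by naturality (Mathlib `NatIso.mapHomologicalComplex` of `twistFunctorCongr`).
[cite: Hartshorne1977, III Ex. 4.5] -/
def cocycleTwistComplexCongr (b : UnitCocycle.Coboundary c c') : cocycleTwistComplex c E₀ ≅ cocycleTwistComplex c' E₀ :=
  (NatIso.mapHomologicalComplex (twistFunctorCongr X.left c c' b) (ComplexShape.up ℤ)).app E₀

/-- The terms of `cocycleTwistComplexCongr` are the module isomorphisms `twistCongr`. [folklore] -/
theorem cocycleTwistComplexCongr_hom_f (b : UnitCocycle.Coboundary c c') (p : ℤ) :
    (cocycleTwistComplexCongr E₀ b).hom.f p = (twistCongr b (E₀.X p)).hom :=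
  rfl

variable [HasDerivedCategory.{w} X.left.Modules] (a b₀ : ℤ) [E₀.IsStrictlyGE a] [E₀.IsStrictlyLE b₀]
  (hK : ∀ p, IsFiniteLocallyFree (E₀.X p))

/-- **The `I`-semiregularity verdict of the strictly perfect `E₀ ⊗ M` depends only on the class of `M`**: for a
coboundary from `c` to `c′` and every `I`, `IsISemiregularC(E₀⟨c⟩) ↔ IsISemiregularC(E₀⟨c′⟩)` (t-7's invariance of the real
`σ_q` under isomorphisms of complexes, at `cocycleTwistComplexCongr`). [cite: BuchweitzFlenner2003, Def. 4.1 and §5] -/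
theorem isISemiregularC_cocycleTwistComplex_iff_of_coboundary (b : UnitCocycle.Coboundary c c') (I : Set ℕ) :
    HomComplex.IsISemiregularC X (cocycleTwistComplex c E₀) a b₀ (isFiniteLocallyFree_cocycleTwistComplex_X c hK) I ↔
      HomComplex.IsISemiregularC X (cocycleTwistComplex c' E₀) a b₀ (isFiniteLocallyFree_cocycleTwistComplex_X c' hK) I :=
  HomComplex.isISemiregularC_iff_of_iso X a b₀ _ _ (cocycleTwistComplexCongr E₀ b) I

/-- Equal classes ⇒ the same verdict for the twisted strictly perfect complex. [cite: BuchweitzFlenner2003, §5] -/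
theorem isISemiregularC_cocycleTwistComplex_iff_of_mk_eq_mk (h : CechPic.mk c = CechPic.mk c') (I : Set ℕ) :
    HomComplex.IsISemiregularC X (cocycleTwistComplex c E₀) a b₀ (isFiniteLocallyFree_cocycleTwistComplex_X c hK) I ↔
      HomComplex.IsISemiregularC X (cocycleTwistComplex c' E₀) a b₀ (isFiniteLocallyFree_cocycleTwistComplex_X c' hK) I := by
  obtain ⟨b⟩ := (CechPic.mk_eq_mk_iff c c').1 h
  exact isISemiregularC_cocycleTwistComplex_iff_of_coboundary E₀ a b₀ hK b I

end Complex

end CocycleTwist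

end Summit.Ventures.HSemireg

end
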